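import Summits.ResolutionOfSingularities.ResolutionOfSingularities.Theorems.PurelyInseparableDim4CleaningDisjoint
import Summits.ResolutionOfSingularities.ResolutionOfSingularities.Theorems.PurelyInseparableDim4LeafStep
import HarnessLib
import HarnessLib.Audit.Tags

/-!
# Purely inseparable fourfolds — NORMAL FORMS `∏ᵢ xᵢ^{aᵢ}(1+xᵢ)^{eᵢ}` for the pure-leaf game over `𝔽₂`
# (cell res-dim4-pi; D3b kit, 3: the product states of `HOME/res-dim4-p-10/D3b-PAPER.md` §1)
# [OURS · counted 0 · bookkeeping identities of OUR frame, not about resolution]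

Width seat `res-dim4-p-10` (g2).  The product states of the paper proof «pure leaves win the global game over `𝔽₂`»
are `N(a,e) = ∏ᵢ xᵢ^{aᵢ}(1+xᵢ)^{eᵢ}` (written out in every statement; no definition).  This file proves the
bookkeeping the transition table needs, over the tree's objects:

* §1 structure (any commutative ring, any finite index type): `N(a,e) = x^a · ∏(1+xᵢ)^{eᵢ}`, `x^a ∣ N` monomialwise,
  `coeff_a N = 1`, hence `ordAlong S N = Σ_{i∈S} aᵢ` and `ord₀ N = |a|` (`LeafStep.ordAlong_eq_degIn`); pulling out
  `x_j²` (`prod_eq_X_sq_mul`) and the SINGLETON CHART `chartTransform 2 {j} j N(a,e) = N(a − 2δ_j, e)`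
  (`PthPowerFactor.chartTransform_singleton_mul`);
* §2 disjoint variables: the factors have pairwise disjoint variables, so the `q`-th-power part of `N` is the product of
  the `q`-th-power parts of the factors (`sub_deletePthPowers_prod_univariate`, from `deletePthPowers_mul_disjoint`);
* §3 over `𝔽₂`: a translation by an `𝔽₂`-point SWAPS `(aᵢ, eᵢ)` at the translated variables (`translate_prod_zmod2`),
  and the square part of one factor `x^a(1+x)^e` (`sub_deletePthPowers_factor_*`: `0` if `a` odd and `e` even;
  `x^a(1+x)^{e−1}` if `a` even and `e` odd; itself if both even).

Nothing here proves resolution of singularities in dimension ≥ 4 / characteristic `p`; counted 0; AI work, weaker than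
expert review. bears_on: LADDER-RESOLUTION:D157-DOOR2 (res-dim4-pi · WORD #60 D3b kit). Supports
stmt-ResolutionOfSingularities-16155 (helper).
-/

set_option linter.dupNamespace false

open MvPolynomial Finset

open scoped BigOperators

noncomputable section

namespace Summit.ResolutionOfSingularities.ResolutionOfSingularities.Theorems.PIDim4

namespace PureLeafNF

open Literature.AlgebraicGeometry.Resolution
open Literature.AlgebraicGeometry.Resolution.Hauser2010
open CentreBlowup PthPowerFactor

variable {σ : Type*} [Fintype σ] [DecidableEq σ] {K : Type*} [CommRing K]

/-! ## 1. Structure of `N(a,e) = ∏ᵢ xᵢ^{aᵢ}(1+xᵢ)^{eᵢ}` -/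

omit [DecidableEq σ] in
/-- `N(a,e) = x^a · ∏ᵢ (1+xᵢ)^{eᵢ}`. [folklore] -/
theorem prod_eq_monomial_mul (a e : σ → ℕ) :
    (∏ i, X i ^ a i * (1 + X i) ^ e i : MvPolynomial σ K) =
      monomial (Finsupp.equivFunOnFinite.symm a) 1 * ∏ i, (1 + X i) ^ e i := by
  rw [Finset.prod_mul_distrib, monomial_eq, C_1, one_mul, Finsupp.prod_fintype _ _ (fun i => pow_zero _)]
  rfl

omit [DecidableEq σ] in
/-- The unit part `∏ᵢ (1+xᵢ)^{eᵢ}` has constant coefficient `1`. [folklore] -/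
theorem coeff_zero_prod_one_add_X_pow (e : σ → ℕ) :
    coeff 0 (∏ i, (1 + X i) ^ e i : MvPolynomial σ K) = 1 := by
  rw [← constantCoeff_eq, map_prod]
  refine Finset.prod_eq_one fun i _ => ?_
  rw [map_pow, map_add, map_one, constantCoeff_X, add_zero, one_pow]

omit [DecidableEq σ] in
/-- **`coeff_a N(a,e) = 1`.** [folklore] -/
theorem coeff_self_prod (a e : σ → ℕ) :
    coeff (Finsupp.equivFunOnFinite.symm a) (∏ i, X i ^ a i * (1 + X i) ^ e i : MvPolynomial σ K) = 1 := by
  rw [prod_eq_monomial_mul]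
  have h := coeff_monomial_mul (0 : σ →₀ ℕ) (Finsupp.equivFunOnFinite.symm a) (1 : K)
    (∏ i, (1 + X i) ^ e i : MvPolynomial σ K)
  rw [add_zero, one_mul, coeff_zero_prod_one_add_X_pow] at h
  exact h

omit [DecidableEq σ] in
/-- **`x^a` divides `N(a,e)` monomialwise.** [folklore] -/
theorem le_of_mem_support_prod (a e : σ → ℕ) {d : σ →₀ ℕ}
    (hd : d ∈ (∏ i, X i ^ a i * (1 + X i) ^ e i : MvPolynomial σ K).support) :
    Finsupp.equivFunOnFinite.symm a ≤ d := by
  rw [prod_eq_monomial_mul, MvPolynomial.mem_support_iff, coeff_monomial_mul'] at hd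
  by_contra h
  rw [if_neg h] at hd
  exact hd rfl

/-- **Pulling out `x_j²`**: if `2 ≤ a_j` then `N(a,e) = x_j² · N(a − 2δ_j, e)`. [folklore] -/
theorem prod_eq_X_sq_mul (a e : σ → ℕ) {j : σ} (hj : 2 ≤ a j) :
    (∏ i, X i ^ a i * (1 + X i) ^ e i : MvPolynomial σ K) =
      X j ^ 2 * ∏ i, X i ^ (Function.update a j (a j - 2)) i * (1 + X i) ^ e i := by
  rw [← Finset.mul_prod_erase Finset.univ _ (Finset.mem_univ j),
    ← Finset.mul_prod_erase Finset.univ (fun i => X i ^ (Function.update a j (a j - 2)) i * (1 + X i) ^ e i)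
      (Finset.mem_univ j)]
  have hrest : ∏ i ∈ Finset.univ.erase j, X i ^ a i * (1 + X i) ^ e i =
      ∏ i ∈ Finset.univ.erase j, (X i ^ (Function.update a j (a j - 2)) i * (1 + X i) ^ e i :
        MvPolynomial σ K) :=
    Finset.prod_congr rfl fun i hi => by rw [Function.update_of_ne (Finset.ne_of_mem_erase hi)]
  rw [hrest, Function.update_self, ← mul_assoc, ← mul_assoc, ← pow_add, Nat.add_sub_cancel' hj]

/-- **THE SINGLETON CHART on a normal form**: `chartTransform 2 {j} j N(a,e) = N(a − 2δ_j, e)` when `2 ≤ a_j`.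
[folklore] -/
theorem chartTransform_singleton_prod (a e : σ → ℕ) {j : σ} (hj : 2 ≤ a j) :
    chartTransform 2 {j} j (∏ i, X i ^ a i * (1 + X i) ^ e i : MvPolynomial σ K) =
      ∏ i, X i ^ (Function.update a j (a j - 2)) i * (1 + X i) ^ e i := by
  rw [prod_eq_X_sq_mul a e hj, chartTransform_singleton_mul]

/-! ## 2. The factors have disjoint variables -/

omit [Fintype σ] [DecidableEq σ] in
/-- The monomials of the factor `x_i^a (1+x_i)^e` involve `x_i` only. [folklore] -/
theorem apply_eq_zero_of_mem_support_factor (i : σ) (a e : ℕ) {d : σ →₀ ℕ}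
    (hd : d ∈ (X i ^ a * (1 + X i) ^ e : MvPolynomial σ K).support) {k : σ} (hk : k ≠ i) : d k = 0 := by
  -- the factor is the renaming of a one-variable polynomial
  have hre : (X i ^ a * (1 + X i) ^ e : MvPolynomial σ K) =
      rename (fun _ : Unit => i) (X () ^ a * (1 + X ()) ^ e : MvPolynomial Unit K) := by
    rw [map_mul, map_pow, map_pow, map_add, map_one, rename_X]
  by_contra hne
  rw [MvPolynomial.mem_support_iff, hre] at hd
  refine hd (coeff_rename_eq_zero _ _ _ fun u hu => ?_)
  exfalso
  have h0 : d k = 0 := by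
    rw [← hu]
    exact Finsupp.mapDomain_notin_range u k (by rintro ⟨x, hx⟩; exact hk hx.symm)
  exact hne h0

omit [Fintype σ] in
/-- The monomials of a product of such factors over `s` vanish outside `s`. [folklore] -/
theorem apply_eq_zero_of_mem_support_prod (s : Finset σ) (a e : σ → ℕ) {d : σ →₀ ℕ}
    (hd : d ∈ (∏ i ∈ s, X i ^ a i * (1 + X i) ^ e i : MvPolynomial σ K).support) {k : σ} (hk : k ∉ s) :
    d k = 0 := by
  classical
  induction s using Finset.induction_on generalizing d with
  | empty =>
    rw [Finset.prod_empty] at hd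
    have : d = 0 := by
      by_contra h
      rw [MvPolynomial.mem_support_iff, ← C_1, coeff_C, if_neg (Ne.symm h)] at hd
      exact hd rfl
    rw [this, Finsupp.coe_zero, Pi.zero_apply]
  | insert j s hjs ih =>
    rw [Finset.prod_insert hjs] at hd
    obtain ⟨u, hu, v, hv, rfl⟩ := Finset.mem_add.mp (support_mul _ _ hd)
    rw [Finsupp.add_apply, apply_eq_zero_of_mem_support_factor j (a j) (e j) hu
      (fun h => hk (by rw [h]; exact Finset.mem_insert_self j s)),
      ih hv (fun h => hk (Finset.mem_insert_of_mem h)), add_zero]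

omit [Fintype σ] in
/-- **The `q`-th-power part of a product of univariate factors is the product of the `q`-th-power parts**
(iterated `deletePthPowers_mul_disjoint`). [folklore] -/
theorem sub_deletePthPowers_prod_univariate (q : ℕ) (s : Finset σ) (a e : σ → ℕ) :
    (∏ i ∈ s, X i ^ a i * (1 + X i) ^ e i : MvPolynomial σ K) -
        deletePthPowers q (∏ i ∈ s, X i ^ a i * (1 + X i) ^ e i) =
      ∏ i ∈ s, ((X i ^ a i * (1 + X i) ^ e i : MvPolynomial σ K) -
        deletePthPowers q (X i ^ a i * (1 + X i) ^ e i)) := by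
  classical
  induction s using Finset.induction_on with
  | empty =>
    have h0 : IsPthPowerExponent q (0 : σ →₀ ℕ) := fun i hi => by
      rw [Finsupp.support_zero] at hi; exact absurd hi (Finset.notMem_empty i)
    rw [Finset.prod_empty, Finset.prod_empty, ← C_1, ← monomial_zero', deletePthPowers_monomial,
      if_pos h0, sub_zero]
  | insert j s hjs ih =>
    rw [Finset.prod_insert hjs, Finset.prod_insert hjs, ← ih,
      deletePthPowers_mul_disjoint q _ _ (fun u hu v hv i => ?_), sub_sub_cancel]
    by_cases hij : i = j
    · right; rw [hij]; exact apply_eq_zero_of_mem_support_prod s a e hv hjs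
    · left; exact apply_eq_zero_of_mem_support_factor j (a j) (e j) hu hij

/-! ## 3. Over characteristic `2`: square parts of one factor; over `𝔽₂`: translations swap `(a, e)` -/

omit [Fintype σ] [DecidableEq σ] in
/-- Every monomial of an `expand q` has all exponents divisible by `q`. [folklore] -/
theorem forall_dvd_of_mem_support_expand (q : ℕ) (ψ : MvPolynomial σ K) :
    ∀ u ∈ (expand q ψ).support, ∀ k, q ∣ u k := by
  intro u hu k
  by_contra h
  exact (MvPolynomial.mem_support_iff.mp hu) (coeff_expand_of_not_dvd ψ h)

section CharTwo

variable [CharP K 2]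

omit [Fintype σ] [DecidableEq σ] in
/-- `(1 + x)² = 1 + x²` in characteristic `2`, i.e. `(1 + x)² = expand 2 (1 + x)`. [folklore] -/
theorem one_add_X_sq (i : σ) : ((1 + X i) ^ 2 : MvPolynomial σ K) = expand 2 (1 + X i) := by
  have h2 : (2 : MvPolynomial σ K) = 0 := CharP.cast_eq_zero (MvPolynomial σ K) 2
  rw [map_add, map_one, expand_X]
  calc ((1 + X i) ^ 2 : MvPolynomial σ K) = 1 + 2 * X i + X i ^ 2 := by ring
    _ = 1 + X i ^ 2 := by rw [h2, zero_mul, add_zero]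

omit [Fintype σ] [DecidableEq σ] in
/-- **Square × residue decomposition of one factor**: `x^a(1+x)^e = expand 2 (x^{a/2}(1+x)^{e/2}) · x^{a%2}(1+x)^{e%2}`.
[folklore] -/
theorem factor_eq_expand_mul (i : σ) (a e : ℕ) :
    (X i ^ a * (1 + X i) ^ e : MvPolynomial σ K) =
      expand 2 (X i ^ (a / 2) * (1 + X i) ^ (e / 2)) * (X i ^ (a % 2) * (1 + X i) ^ (e % 2)) := by
  rw [map_mul, map_pow, map_pow, expand_X, ← one_add_X_sq, ← pow_mul, ← pow_mul]
  conv_lhs => rw [← Nat.div_add_mod a 2, ← Nat.div_add_mod e 2, pow_add, pow_add]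
  ring

omit [Fintype σ] in
/-- The square part of one factor is its `expand` part times the square part of the residue
`x^{a%2}(1+x)^{e%2}`. [folklore] -/
theorem sub_deletePthPowers_factor (i : σ) (a e : ℕ) :
    (X i ^ a * (1 + X i) ^ e : MvPolynomial σ K) - deletePthPowers 2 (X i ^ a * (1 + X i) ^ e) =
      expand 2 (X i ^ (a / 2) * (1 + X i) ^ (e / 2)) *
        ((X i ^ (a % 2) * (1 + X i) ^ (e % 2) : MvPolynomial σ K) -
          deletePthPowers 2 (X i ^ (a % 2) * (1 + X i) ^ (e % 2))) := by
  rw [factor_eq_expand_mul i a e, deletePthPowers_mul_of_forall_dvd 2 _ _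
    (forall_dvd_of_mem_support_expand 2 _), mul_sub]

omit [Fintype σ] [CharP K 2] in
/-- Square parts of the four residues: `1 ↦ 1`, `x ↦ 0`, `1 + x ↦ 1`, `x(1+x) ↦ x²`. [folklore] -/
theorem sub_deletePthPowers_residue (i : σ) (ε η : ℕ) (hε : ε < 2) (hη : η < 2) :
    ((X i ^ ε * (1 + X i) ^ η : MvPolynomial σ K) - deletePthPowers 2 (X i ^ ε * (1 + X i) ^ η)) =
      if ε = 0 then 1 else (if η = 0 then 0 else X i ^ 2) := by
  have hone : deletePthPowers 2 (1 : MvPolynomial σ K) = 0 := by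
    rw [← C_1, ← monomial_zero', deletePthPowers_monomial, if_pos]
    intro k hk; rw [Finsupp.support_zero] at hk; exact absurd hk (Finset.notMem_empty k)
  have hX : deletePthPowers 2 (X i : MvPolynomial σ K) = X i := by
    rw [X, deletePthPowers_monomial, if_neg]
    intro h
    have := (isPthPowerExponent_iff 2 _).mp h i
    rw [Finsupp.single_eq_same] at this
    omega
  have hX2 : deletePthPowers 2 (X i ^ 2 : MvPolynomial σ K) = 0 := by
    rw [X_pow_eq_monomial, deletePthPowers_monomial, if_pos]
    refine (isPthPowerExponent_iff 2 _).mpr fun k => ?_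
    rw [Finsupp.single_apply]; split_ifs <;> simp
  interval_cases ε <;> interval_cases η
  · simp only [pow_zero, mul_one, if_true]; rw [hone, sub_zero]
  · simp only [pow_zero, pow_one, one_mul, if_true]
    rw [deletePthPowers_add, hone, hX, zero_add, add_sub_cancel_right]
  · simp only [pow_one, pow_zero, mul_one, one_ne_zero, if_false, if_true]; rw [hX, sub_self]
  · simp only [pow_one, one_ne_zero, if_false]
    rw [mul_add, mul_one, ← pow_two, deletePthPowers_add, hX, hX2, add_zero, add_sub_cancel_left]

end CharTwo

omit [DecidableEq σ] in
/-- **Over `𝔽₂` a translation SWAPS `(aᵢ, eᵢ)` at the translated variables**: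
`translate b N(a,e) = N(a',e')`, `(a',e')ᵢ = (eᵢ,aᵢ)` if `bᵢ ≠ 0`, else `(aᵢ,eᵢ)`. [folklore] -/
theorem translate_prod_zmod2 (b : σ → ZMod 2) (a e : σ → ℕ) :
    PointBlowup.translate b (∏ i, X i ^ a i * (1 + X i) ^ e i : MvPolynomial σ (ZMod 2)) =
      ∏ i, X i ^ (if b i = 0 then a i else e i) * (1 + X i) ^ (if b i = 0 then e i else a i) := by
  unfold PointBlowup.translate
  rw [map_prod]
  refine Finset.prod_congr rfl fun i _ => ?_
  rw [map_mul, map_pow, map_pow, map_add, map_one, aeval_X]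
  have h01 : ∀ x : ZMod 2, x = 0 ∨ x = 1 := by decide
  rcases h01 (b i) with h0 | h1
  · rw [h0, C_0, add_zero, if_pos rfl, if_pos rfl]
  · have h11 : (X i + C 1 : MvPolynomial σ (ZMod 2)) = 1 + X i := by rw [C_1, add_comm]
    have h12 : (1 + (X i + C 1) : MvPolynomial σ (ZMod 2)) = X i := by
      rw [C_1, add_comm (X i) 1, ← add_assoc, ← C_1, ← C_add, show (1 : ZMod 2) + 1 = 0 from rfl, C_0,
        zero_add]
    rw [h1, if_neg one_ne_zero, if_neg one_ne_zero, h12, h11, mul_comm]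


end PureLeafNF

end Summit.ResolutionOfSingularities.ResolutionOfSingularities.Theorems.PIDim4

end
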